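import Summits.KontsevichZagierPeriods.Zeta5Search.WedgeDictionaryRankTwo
import HarnessLib

/-!
# Slot symmetry of `M₃` and the linear-functional summability principle (cell `pub-zeta5`)

HONEST FRAMING: systematic search; no irrationality claim unless certified.

OUR work (Summit side; lead/literature seat generation 4, 2026-08-20). Tools for CF-M3 (`casoratianClosedForm`) used by
`WedgeDictionaryFace` (the face `b₇ = 0` transported to every face `b_j = 0`) and offered to the P1/gen-1 interior
programme (PROOF-NOTES-g5 §10, L4):

* `quadM3_congr'`: `M₃(b)` (`quadM3`), `U(b)`, `W(b)` and the canonical data depend on `b₀` and `numPoly b` only;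
  `quadM3_congr`: hence on `b₀,…,b₇` only.
* `numPoly_swap`, `quadM3_swap`, `coeffU_swap`, `coeffW_swap`: they are SYMMETRIC in the seven slots `b₁,…,b₇`
  (`numPoly` is a product over the slots).
* `coeff_rel_of_summable_sum`: if a finite combination `Σᵢ cᵢ·numPoly(bᵢ)` of numerators at a common level `N`
  is SUMMABLE, `= g(X+1)X⁶ − g·(X+N)⁶` with `deg g < 6N`, then `Σᵢ cᵢ U(bᵢ) = 0 = Σᵢ cᵢ W(bᵢ)` (gen-1 g4's summability
  principle behind `rank_two`, in linear-functional form, any number of terms; the 3-term case is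
  `WedgeDictionaryFaceAbel.coeff_rel_of_summable`).
-/

noncomputable section

open Finset Polynomial

namespace Summit.KontsevichZagierPeriods.Zeta5Search.WedgeDictionary

open Summit.KontsevichZagierPeriods.Zeta5Search.DualSeries
open Literature.NumberTheory.Transcendental
open Literature.NumberTheory.Transcendental.BallRivoal (pfEval pf_unique poch_pos pochPoly eval_pochPoly)

/-! ### `M₃(b)` depends on `b₀,…,b₇` only -/

/-- `numPoly b` depends on `b 0, …, b 7` only. -/
theorem numPoly_congr {b b' : ℕ → ℤ} (h : ∀ j, j ≤ 7 → b j = b' j) : numPoly b = numPoly b' := by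
  have hprod : ∏ j ∈ range 7, (pochPoly 0 (b (j + 1)).toNat * pochPoly ((b 0 - b (j + 1) + 1 : ℤ) : ℚ) (b (j + 1)).toNat) =
      ∏ j ∈ range 7, (pochPoly 0 (b' (j + 1)).toNat * pochPoly ((b' 0 - b' (j + 1) + 1 : ℤ) : ℚ) (b' (j + 1)).toNat) :=
    prod_congr rfl fun j hj => by rw [h 0 (by norm_num), h (j + 1) (by have := mem_range.1 hj; omega)]
  unfold numPoly
  rw [hprod, h 0 (by norm_num)]

/-- `IsPFData b` depends on `b 0` and `numPoly b` only. -/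
theorem isPFData_congr' {b b' : ℕ → ℤ} (h0 : b 0 = b' 0) (hnum : numPoly b = numPoly b') :
    IsPFData b = IsPFData b' := by
  funext c
  unfold IsPFData
  rw [h0, hnum]

/-- The canonical data `pfData b` depend on `b 0` and `numPoly b` only. -/
theorem pfData_congr' {b b' : ℕ → ℤ} (h0 : b 0 = b' 0) (hnum : numPoly b = numPoly b') : pfData b = pfData b' := by
  unfold pfData
  rw [isPFData_congr' h0 hnum]

/-- `coeffU b` depends on `b 0` and `numPoly b` only. -/
theorem coeffU_congr' {b b' : ℕ → ℤ} (h0 : b 0 = b' 0) (hnum : numPoly b = numPoly b') : coeffU b = coeffU b' := by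
  unfold coeffU
  rw [h0, pfData_congr' h0 hnum]

/-- `coeffW b` depends on `b 0` and `numPoly b` only. -/
theorem coeffW_congr' {b b' : ℕ → ℤ} (h0 : b 0 = b' 0) (hnum : numPoly b = numPoly b') : coeffW b = coeffW b' := by
  unfold coeffW
  rw [h0, pfData_congr' h0 hnum]

/-- `M₃(b)` depends on `b 0` and `numPoly b` only (so it is symmetric in the slots `b₁,…,b₇`, see
`WedgeDictionaryFaceSymmetric`). -/
theorem quadM3_congr' {b b' : ℕ → ℤ} (h0 : b 0 = b' 0) (hnum : numPoly b = numPoly b') : quadM3 b = quadM3 b' := by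
  unfold quadM3
  rw [coeffU_congr' h0 hnum, coeffW_congr' h0 hnum, h0, pfData_congr' h0 hnum]

/-- `M₃(b) = M₃(b')` as soon as `b` and `b'` agree on `0,…,7`. -/
theorem quadM3_congr {b b' : ℕ → ℤ} (h : ∀ j, j ≤ 7 → b j = b' j) : quadM3 b = quadM3 b' :=
  quadM3_congr' (h 0 (by norm_num)) (numPoly_congr h)

/-! ### Slot symmetry -/

/-- A transposition of two slots `j, k ≥ 1`, conjugated to the `range 7` indexing `i ↦ i+1`. -/
theorem swap_succ {j k : ℕ} (hj : 1 ≤ j) (hk : 1 ≤ k) (i : ℕ) :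
    Equiv.swap j k (i + 1) = Equiv.swap (j - 1) (k - 1) i + 1 := by
  rw [Equiv.swap_apply_def, Equiv.swap_apply_def]
  split_ifs <;> omega

/-- `numPoly` is symmetric in the slots `b₁,…,b₇`. -/
theorem numPoly_swap (b : ℕ → ℤ) {j k : ℕ} (hj : j ∈ Icc 1 7) (hk : k ∈ Icc 1 7) :
    numPoly (fun i => b (Equiv.swap j k i)) = numPoly b := by
  obtain ⟨hj1, hj7⟩ := mem_Icc.1 hj
  obtain ⟨hk1, hk7⟩ := mem_Icc.1 hk
  have h0 : Equiv.swap j k 0 = 0 := Equiv.swap_apply_of_ne_of_ne (by omega) (by omega)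
  have hprod : ∏ i ∈ range 7, (pochPoly 0 (b (Equiv.swap j k (i + 1))).toNat *
        pochPoly ((b 0 - b (Equiv.swap j k (i + 1)) + 1 : ℤ) : ℚ) (b (Equiv.swap j k (i + 1))).toNat) =
      ∏ i ∈ range 7, (pochPoly 0 (b (i + 1)).toNat * pochPoly ((b 0 - b (i + 1) + 1 : ℤ) : ℚ) (b (i + 1)).toNat) := by
    refine Finset.prod_equiv (Equiv.swap (j - 1) (k - 1)) (fun i => ?_) (fun i _ => by rw [swap_succ hj1 hk1])
    simp only [mem_range]
    rw [Equiv.swap_apply_def]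
    split_ifs <;> omega
  unfold numPoly
  dsimp only
  rw [h0, hprod]

/-- **`M₃` is symmetric in the slots `b₁,…,b₇`.** -/
theorem quadM3_swap (b : ℕ → ℤ) {j k : ℕ} (hj : j ∈ Icc 1 7) (hk : k ∈ Icc 1 7) :
    quadM3 (fun i => b (Equiv.swap j k i)) = quadM3 b :=
  quadM3_congr' (show b (Equiv.swap j k 0) = b 0 by
    rw [Equiv.swap_apply_of_ne_of_ne (by have := (mem_Icc.1 hj).1; omega) (by have := (mem_Icc.1 hk).1; omega)])
    (numPoly_swap b hj hk)

/-- `U` is symmetric in the slots `b₁,…,b₇`. -/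
theorem coeffU_swap (b : ℕ → ℤ) {j k : ℕ} (hj : j ∈ Icc 1 7) (hk : k ∈ Icc 1 7) :
    coeffU (fun i => b (Equiv.swap j k i)) = coeffU b :=
  coeffU_congr' (show b (Equiv.swap j k 0) = b 0 by
    rw [Equiv.swap_apply_of_ne_of_ne (by have := (mem_Icc.1 hj).1; omega) (by have := (mem_Icc.1 hk).1; omega)])
    (numPoly_swap b hj hk)

/-- `W` is symmetric in the slots `b₁,…,b₇`. -/
theorem coeffW_swap (b : ℕ → ℤ) {j k : ℕ} (hj : j ∈ Icc 1 7) (hk : k ∈ Icc 1 7) :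
    coeffW (fun i => b (Equiv.swap j k i)) = coeffW b :=
  coeffW_congr' (show b (Equiv.swap j k 0) = b 0 by
    rw [Equiv.swap_apply_of_ne_of_ne (by have := (mem_Icc.1 hj).1; omega) (by have := (mem_Icc.1 hk).1; omega)])
    (numPoly_swap b hj hk)

/-! ### The linear-functional summability principle -/

/-- **Summable combinations have vanishing coefficient sums** (any number of terms). Let `bᵢ` (`i ∈ s`) lie in the
box at a common level `N ≥ 1` with `Σ_j (bᵢ)_j ≤ 3N+1`, and suppose
`Σᵢ cᵢ·numPoly(bᵢ) = g(X+1)·X⁶ − g·(X+N)⁶` with `deg g < 6N`. Then `Σᵢ cᵢ·U(bᵢ) = 0` and `Σᵢ cᵢ·W(bᵢ) = 0`. -/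
theorem coeff_rel_of_summable_sum {ι : Type*} (s : Finset ι) (bv : ι → ℕ → ℤ) (c : ι → ℚ) (N : ℕ) (hN : 1 ≤ N)
    (hbox : ∀ i ∈ s, InBox (bv i)) (hsum : ∀ i ∈ s, ∑ j ∈ range 7, bv i (j + 1) ≤ 3 * bv i 0 + 1)
    (hlev : ∀ i ∈ s, (bv i 0).toNat = N) (g : ℚ[X]) (hg : g.natDegree + 1 ≤ 6 * N)
    (hrel : ∑ i ∈ s, C (c i) * numPoly (bv i) = g.comp (X + C 1) * X ^ 6 - g * (X + C (N : ℚ)) ^ 6) :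
    ∑ i ∈ s, c i * coeffU (bv i) = 0 ∧ ∑ i ∈ s, c i * coeffW (bv i) = 0 := by
  classical
  have hdata : ∀ i ∈ s, ∃ d : ℕ → ℕ → ℚ, IsPFData (bv i) d := fun i hi => exists_isPFData _ (hbox i hi) (hsum i hi)
  choose! d hd using hdata
  obtain ⟨γ, hγ⟩ := exists_pf_summable hN hg
  set D : ℕ → ℕ → ℚ := fun o p => ∑ i ∈ s, c i * d i o p with hD
  set e : ℕ → ℕ → ℚ := fun o p => D o p + padData (N - 1) γ o p - shiftUp γ o p with he
  have hDeval : ∀ t : ℚ, pfEval N 6 D t = ∑ i ∈ s, c i * pfEval N 6 (d i) t := by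
    intro t
    unfold pfEval
    simp only [hD, sum_div, mul_sum]
    simp_rw [Finset.sum_comm (s := range 6) (t := s)]
    rw [Finset.sum_comm (s := range (N + 1)) (t := s)]
    refine sum_congr rfl fun i _ => sum_congr rfl fun p _ => sum_congr rfl fun o _ => ?_
    ring
  have heval : ∀ t : ℚ, pfEval N 6 e t =
      pfEval N 6 D t + pfEval N 6 (padData (N - 1) γ) t - pfEval N 6 (shiftUp γ) t := by
    intro t
    unfold pfEval
    simp only [he, add_div, sub_div, sum_add_distrib, sum_sub_distrib]
  -- the combination is `polyNum N Φ` for `Φ = Σ cᵢ Π(bᵢ)`, so `polyNum_telescope` applies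
  have hP : ∑ i ∈ s, C (c i) * numPoly (bv i) = polyNum N (∑ i ∈ s, C (c i) * PiPoly (bv i)) := by
    rw [polyNum_sum]
    refine sum_congr rfl fun i hi => ?_
    rw [polyNum_smul, ← hlev i hi, ← numPoly_eq_polyNum (bv i) (hbox i hi)]
  have hΦ : polyNum N (∑ i ∈ s, C (c i) * PiPoly (bv i)) = g.comp (X + C 1) * X ^ 6 - g * (X + C (N : ℚ)) ^ 6 := by
    rw [← hP]; exact hrel
  have he0 : ∀ t : ℕ, pfEval N 6 e t = 0 := by
    intro t
    have E : ∀ i ∈ s, pfEval N 6 (d i) t =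
        ((numPoly (bv i)).comp (X + C 1)).eval (t : ℚ) / BallRivoal.poch ((t : ℚ) + 1) (N + 1) ^ 6 := by
      intro i hi
      have h := hd i hi (t : ℚ) (fun p _ => by positivity)
      rwa [hlev i hi] at h
    have Esh : pfEval N 6 (shiftUp γ) t = pfEval (N - 1) 6 γ ((t : ℚ) + 1) := by
      rw [show N = (N - 1) + 1 from by omega, pfEval_shiftUp, show N - 1 + 1 - 1 = N - 1 by omega]
    have Epad : pfEval N 6 (padData (N - 1) γ) t = pfEval (N - 1) 6 γ t := pfEval_padData (by omega) _ _ _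
    have Etel := polyNum_telescope hN hΦ hγ t
    rw [← hP] at Etel
    rw [heval, hDeval, sum_congr rfl fun i hi => by rw [E i hi], Esh, Epad]
    simp only [eval_comp, eval_finsetSum, eval_mul, eval_C, eval_add, eval_X] at Etel ⊢
    simp only [← mul_div_assoc, ← sum_div]
    linear_combination Etel
  have hz : ∀ {o : ℕ}, o < 6 → ∑ p ∈ range (N + 1), e o p = 0 := fun ho =>
    sum_eq_zero_of_pfEval_zero N 6 e he0 ho
  have htel : ∀ o, ∑ p ∈ range (N + 1), (padData (N - 1) γ o p - shiftUp γ o p) = 0 := by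
    intro o
    rw [sum_sub_distrib, show N + 1 = (N - 1) + 2 by omega, sum_shiftUp,
      show N - 1 + 2 = (N - 1 + 1) + 1 by omega, sum_padData (by omega), sub_self]
  have hexp : ∀ o, ∑ p ∈ range (N + 1), e o p = ∑ i ∈ s, c i * ∑ p ∈ range (N + 1), d i o p := by
    intro o
    calc ∑ p ∈ range (N + 1), e o p
        = ∑ p ∈ range (N + 1), D o p + ∑ p ∈ range (N + 1), (padData (N - 1) γ o p - shiftUp γ o p) := by
          rw [← sum_add_distrib]
          exact sum_congr rfl fun p _ => by simp only [he]; ring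
      _ = ∑ i ∈ s, c i * ∑ p ∈ range (N + 1), d i o p := by
          rw [htel, add_zero]
          simp only [hD]
          rw [Finset.sum_comm]
          exact sum_congr rfl fun i _ => by rw [mul_sum]
  refine ⟨?_, ?_⟩
  · rw [← hz (show 4 < 6 by norm_num), hexp]
    exact sum_congr rfl fun i hi => by rw [coeffU_eq (hd i hi), hlev i hi]
  · rw [← hz (show 2 < 6 by norm_num), hexp]
    exact sum_congr rfl fun i hi => by rw [coeffW_eq (hd i hi), hlev i hi]

end Summit.KontsevichZagierPeriods.Zeta5Search.WedgeDictionary
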